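/-
COR-CM (cell pub-hodgecm2, stage 2 of the Hodge ladder) — TRANSPOSITION item (vi): VACUITY DISCIPLINE for the ADMISSIBILITY-FREE, PIN-FREE
witness / socket forms of `Transposition/AssemblyFree.lean` (p277409 ✔), per RULING B01-R1 (b) «vacuity lemmas + shadow-falsity theorem
per displayed hypothesis» (pattern of `Transposition/AssemblyNonVacuity.lean`, p274034).  Seat prover-pub-hodgecm2-item6-p3-0.  Theorems only;
nothing cited, nothing asserted.  FRAMING (COORDINATOR RULING 2026-08-21T11:55:35Z): HC_CM is NOT proved.
-/
import Summits.HodgeConjecture.CorCM.B01.Transposition.AssemblyNonVacuity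
import HarnessLib

/-!
# The free witness / socket forms are falsifiable and bookkeeping-free: they FAIL on the PerL shadow

`Transposition/AssemblyFree.lean` derives `HC_CM` on the universe of record from either of two hypotheses that are WEAKER than the
day-1 socket `FaceThetaDataExists` and than the witness form of `FacePeriodWitnesses.lean`: no admissibility, surface embedding `ι₁`
and eigen-embedding `σ` unrelated —

  (W)  `∀ F` Galois CM, `6 ≤ [F:ℚ]`, `∀ f`, `∃ (ι₁) (V : HermSpace3 F ι₁) (σ), U.PeriodNV ι₁ V F f.psi σ`;
  (S)  `∀ F` Galois CM, `6 ≤ [F:ℚ]`, `∀ f`, `∃ (ι₁) (V : HermSpace3 F ι₁) (σ), Nonempty (U.FaceThetaDatum ι₁ V F f.psi σ)`.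

Weakening a hypothesis raises the vacuity question anew; this file answers it exactly as for the day-1 forms:

* `Universe.not_exists_periodNV_free_perLShadow`, `Universe.not_exists_faceThetaDatum_free_perLShadow` — (W) and (S) are FALSE on the
  PerL shadow `U.perLShadow` of every universe (witness field `ℚ(ζ₇)`: Galois, degree `6 ∉ {24, 48}`; on the shadow every `U_Ψ(Γ)` is `⊥`
  and no period datum has a non-zero period — `perLShadow_not_periodNV`, `isEmpty_faceThetaDatum_perLShadow`, both generic in `σ`
  and in the surface embedding);
* `Universe.not_forall_perL_imp_exists_periodNV_free`, `…_faceThetaDatum_free` (relative to M13 + M14) and the unconditional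
  `not_forall_perL_imp_exists_periodNV_free`, `not_forall_perL_imp_exists_faceThetaDatum_free` (CM-type universe) — neither free form
  is a universe-uniform consequence of `PerL`; a discharge must use the model universe;
* the binder prefix `∀ F Galois, 6 ≤ [F:ℚ], ∀ f` is inhabited (`faceThetaDataExists_binders_inhabited`, `AssemblyNonVacuity.lean:106`,
  unchanged), so neither form is vacuously true by an empty range; and the day-1 forms imply the free ones
  (`exists_periodNV_free_of_exists_periodNV`, `exists_faceThetaDatum_free_of_faceThetaDataExists`, `AssemblyFree.lean`), so the
  day-1 shadow-falsity `not_faceThetaDataExists_perLShadow` is a corollary of the free one.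
-/

noncomputable section

open NumberField

namespace Summit.HodgeConjecture.CorCM

open Literature.AlgebraicGeometry.Motives (CMType)
open Literature.NumberTheory.Automorphic

namespace Universe

variable (U : Universe)

/-- **The free witness form (W) FAILS on the PerL shadow**: at `F = ℚ(ζ₇)` (Galois, degree `6 ∉ {24, 48}`) no period datum of the
shadow has a non-zero period, at ANY surface embedding `ι₁`, ANY `V`, ANY eigen-embedding `σ` (`perLShadow_not_periodNV`). [folklore] -/
theorem not_exists_periodNV_free_perLShadow :
    ¬ ∀ (F : CMField), IsGalois ℚ F → 6 ≤ Module.finrank ℚ F → ∀ f : Face F,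
      ∃ (ι₁ : F →+* ℂ) (V : HermSpace3 F ι₁) (σ : F →+* ℂ), U.perLShadow.PeriodNV ι₁ V F f.psi σ := by
  intro h
  let F : CMField := ⟨CyclotomicField.{0} 7 ℚ⟩
  have hG : IsGalois ℚ F := isGalois_cyclotomicField_seven
  have h6 : Module.finrank ℚ F = 6 := UnitaryGroup.finrank_cyclotomicField_seven
  obtain ⟨f, -, -⟩ := exists_face_admissible F h6.ge
  obtain ⟨ι₁, V, σ, hσ⟩ := h F hG h6.ge f
  exact U.perLShadow_not_periodNV (by omega) ι₁ V F f.psi σ hσ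

/-- **The free socket form (S) FAILS on the PerL shadow**: at `F = ℚ(ζ₇)` no face theta datum exists on the shadow at ANY
`(ι₁, V, σ)` (`isEmpty_faceThetaDatum_perLShadow`: `lineField` + `Theta_sub` + `U_Ψ(Γ) = ⊥`). [folklore] -/
theorem not_exists_faceThetaDatum_free_perLShadow :
    ¬ ∀ (F : CMField), IsGalois ℚ F → 6 ≤ Module.finrank ℚ F → ∀ f : Face F,
      ∃ (ι₁ : F →+* ℂ) (V : HermSpace3 F ι₁) (σ : F →+* ℂ), Nonempty (U.perLShadow.FaceThetaDatum ι₁ V F f.psi σ) := by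
  intro h
  let F : CMField := ⟨CyclotomicField.{0} 7 ℚ⟩
  have hG : IsGalois ℚ F := isGalois_cyclotomicField_seven
  have h6 : Module.finrank ℚ F = 6 := UnitaryGroup.finrank_cyclotomicField_seven
  obtain ⟨f, -, -⟩ := exists_face_admissible F h6.ge
  obtain ⟨ι₁, V, σ, ⟨R⟩⟩ := h F hG h6.ge f
  exact (U.isEmpty_faceThetaDatum_perLShadow (by omega) ι₁ V F f.psi σ).false R

/-- Hence (W) is not a universe-uniform consequence of `PerL` (relative to M13 + M14: the shadow satisfies `PerL`). [folklore] -/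
theorem not_forall_perL_imp_exists_periodNV_free (hE : U.Fact_eigenLine) (hA : U.Fact_alphaLine) :
    ¬ ∀ U' : Universe, U'.PerL → ∀ (F : CMField), IsGalois ℚ F → 6 ≤ Module.finrank ℚ F → ∀ f : Face F,
      ∃ (ι₁ : F →+* ℂ) (V : HermSpace3 F ι₁) (σ : F →+* ℂ), U'.PeriodNV ι₁ V F f.psi σ :=
  fun h => U.not_exists_periodNV_free_perLShadow (h _ (U.perLShadow_perL hE hA))

/-- Hence (S) is not a universe-uniform consequence of `PerL` (relative to M13 + M14). [folklore] -/
theorem not_forall_perL_imp_exists_faceThetaDatum_free (hE : U.Fact_eigenLine) (hA : U.Fact_alphaLine) :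
    ¬ ∀ U' : Universe, U'.PerL → ∀ (F : CMField), IsGalois ℚ F → 6 ≤ Module.finrank ℚ F → ∀ f : Face F,
      ∃ (ι₁ : F →+* ℂ) (V : HermSpace3 F ι₁) (σ : F →+* ℂ), Nonempty (U'.FaceThetaDatum ι₁ V F f.psi σ) :=
  fun h => U.not_exists_faceThetaDatum_free_perLShadow (h _ (U.perLShadow_perL hE hA))

end Universe

/-- **Unconditionally: `∀ U, U.PerL → (W)` is false** (PerL shadow of the CM-type universe, where M13/M14 are theorems). [folklore] -/
theorem not_forall_perL_imp_exists_periodNV_free :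
    ¬ ∀ U : Universe, U.PerL → ∀ (F : CMField), IsGalois ℚ F → 6 ≤ Module.finrank ℚ F → ∀ f : Face F,
      ∃ (ι₁ : F →+* ℂ) (V : HermSpace3 F ι₁) (σ : F →+* ℂ), U.PeriodNV ι₁ V F f.psi σ :=
  cmTypeUniverse.not_forall_perL_imp_exists_periodNV_free cmTypeUniverse_fact_eigenLine cmTypeUniverse_fact_alphaLine

/-- **Unconditionally: `∀ U, U.PerL → (S)` is false** (PerL shadow of the CM-type universe). [folklore] -/
theorem not_forall_perL_imp_exists_faceThetaDatum_free :
    ¬ ∀ U : Universe, U.PerL → ∀ (F : CMField), IsGalois ℚ F → 6 ≤ Module.finrank ℚ F → ∀ f : Face F,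
      ∃ (ι₁ : F →+* ℂ) (V : HermSpace3 F ι₁) (σ : F →+* ℂ), Nonempty (U.FaceThetaDatum ι₁ V F f.psi σ) :=
  cmTypeUniverse.not_forall_perL_imp_exists_faceThetaDatum_free cmTypeUniverse_fact_eigenLine cmTypeUniverse_fact_alphaLine

end Summit.HodgeConjecture.CorCM

end
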